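import Literature.NumberTheory.ComplexMultiplication.GeneralisedHalfTransferTransport
import Literature.NumberTheory.ComplexMultiplication.SectionTwistedAutomorphismGroup
import HarnessLib

/-!
# Change of model for `(Γ, X)`: `ρ_s`, (2.1.1.5) and `ˢF̃_α` along an isomorphism of groups WITH sets `(e, τ) : (G, X) ≅ (G′, X′)`
# (Nekovář, *Hidden symmetries in the theory of complex multiplication*, Notation, §1.1.2, Prop. 1.1.6, §2.1)

Topic `NumberTheory/ComplexMultiplication`; namespace `Literature.NumberTheory.ComplexMultiplication`.  Lane
`lit-hodgefound` (Track 2, Layer A3 skeleton seat `skel-3`, row A3-G77), over rows A3-G65/A3-G66 (`PermWreath`, `ρ_s`, `ˢF̃_α`),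
A3-G72 (`PermWreath.congrLeft`) and A3-G75 (`PermWreath.congrRight`, transport along `τ : X ≃ X′` for ONE group).  Row A3-G76 showed
that the tree's two incarnations of `Γ_ℚ` (`absoluteGaloisGroup ℚ` and `Aut_ℚ(Q̄)`) are related by an honest isomorphism
`absGaloisToAut`, not by a definitional identification usable in rewriting; so the bridge between the coset model (row A3-G67,
`G = absoluteGaloisGroup ℚ`) and the embedding model (rows A3-G71–A3-G73, `G′ = Aut_ℚ(Q̄)`) needs transport along a PAIR
`(e : G ≃* G′, τ : X ≃ X′)` with `τ (g • x) = e g • τ x`.  This file proves it abstractly: definitions with bodies (`subgroupIso`,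
`PermWreath.isoTransport`) and theorems, all proved; no instance, no named fact (D-0026).

## The print, verbatim

J. Nekovář, *Hidden symmetries in the theory of complex multiplication*, Progr. Math. 270 (2009) 399–437
[Nekovar2009HiddenSymmetries], Notation (held `book:tschinkel2009-algebra-arithmetic-geometry-volume-ii-honor-yu` p0417, printed p. 402):
«The restriction map `g ↦ g|_L` induces an isomorphism of left `Γ_ℚ`-sets `Γ_ℚ/Γ_L ≅ X(L)`»; Prop. 1.1.6 (i) (p0420, printed p. 407):
«The bijection `X ⥲ X′` […] gives rise to […] `σ′(x′) = σ(x)′`, `h′(x′) = …`» and Prop. 1.1.4 (p0419, printed p. 406): «an injective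
morphism of exact sequences» (functoriality of `S_X ⋉ H^X` in BOTH variables).

## What is formalised

For groups `G`, `G′`, a `G`-set `X`, a `G′`-set `X′`, `e : G ≃* G′` and `τ : X ≃ X′` with `hτ : τ (g • x) = e g • τ x`:
* §1 `subgroupIso e H : H ≃* e(H)` (Mathlib's `MulEquiv.subgroupMap` in the `toMonoidHom` spelling), `mem_map_toMonoidHom_iff`;
  **`PermWreath.isoTransport e H τ : S_X ⋉ H^X ≅ S_{X′} ⋉ e(H)^{X′}`** (`= congrLeft (subgroupIso e H) ∘ congrRight τ`;
  `coe_isoTransport_left`, `isoTransport_right_apply`, `coe_hcoord_isoTransport`).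
* §2 `equivariant_symm_smul`, `mem_map_iff_smul_eq` (`e(H) = Stab(τ x₀)`), `iso_section_smul` (`s′ = e ∘ s ∘ τ⁻¹` is a section),
  **`isoTransport_wreathEmbedding : isoTransport (ρ_s(g)) = ρ_{s′}(e g)`**.
* §3 **`IsCMStabilizerPair.isoTransport`** (the §1.3 hypotheses for `(e(H), e(N), e c, τ x₀)`), `cmParity_map`,
  `liftConj_isoTransport`, `typeAct_isoTransport`, `ghtBracket_isoTransport`, **`genHalfTransferWith_isoTransport`**
  (`^{s′}F̃_{α∘τ⁻¹}((e,τ)·u) = ˢF̃_α(u)` for `ϕ′ = ϕ ∘ e⁻¹`) and **`genHalfTransferWith_isoTransport_wreathEmbedding`**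
  (`^{s′}F̃_{α′}(ρ_{s′}(e g)) = ˢF̃_α(ρ_s(g))`).

## References

* J. Nekovář, *Hidden symmetries in the theory of complex multiplication*, Progr. Math. 270 (2009) 399–437, Notation, Prop. 1.1.4,
  Prop. 1.1.6, §2.1. [Nekovar2009HiddenSymmetries]

## Provenance

Lane `lit-hodgefound`, seat `literature-prover-lit-hodgefound-skel-3-g40-0` (row A3-G77).
-/

noncomputable section

namespace Literature.NumberTheory.ComplexMultiplication

open SemidirectProduct PermWreath

/-! ### §1. `H ≅ e(H)` and `S_X ⋉ H^X ≅ S_{X′} ⋉ e(H)^{X′}` -/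

section Subgroup

variable {G G' : Type*} [Group G] [Group G'] (e : G ≃* G') (H : Subgroup G)

/-- `H ≅ e(H)` (Mathlib's `MulEquiv.subgroupMap`, with the image spelled `H.map e.toMonoidHom`). [cite: Nekovar2009HiddenSymmetries, Prop. 1.1.4] -/
def subgroupIso : H ≃* H.map e.toMonoidHom := e.subgroupMap H

/-- Unfolding. [cite: Nekovar2009HiddenSymmetries, Prop. 1.1.4] -/
@[simp] theorem coe_subgroupIso_apply (h : H) : ((subgroupIso e H h : H.map e.toMonoidHom) : G') = e h := rfl

/-- Unfolding (inverse). [cite: Nekovar2009HiddenSymmetries, Prop. 1.1.4] -/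
@[simp] theorem coe_subgroupIso_symm_apply (h' : H.map e.toMonoidHom) : (((subgroupIso e H).symm h' : H) : G) = e.symm h' := rfl

/-- `e g ∈ e(H) ↔ g ∈ H`. [cite: Nekovar2009HiddenSymmetries, Prop. 1.1.4] -/
theorem mem_map_toMonoidHom_iff (g : G) : e g ∈ H.map e.toMonoidHom ↔ g ∈ H := by
  rw [Subgroup.mem_map_equiv, MulEquiv.symm_apply_apply]

end Subgroup

namespace PermWreath

variable {G G' : Type*} [Group G] [Group G'] (e : G ≃* G') (H : Subgroup G) {X X' : Type*} (τ : X ≃ X')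

/-- **`S_X ⋉ H^X ≅ S_{X′} ⋉ e(H)^{X′}` along `(e, τ)`**: `(σ, h) ↦ (τστ⁻¹, e ∘ h ∘ τ⁻¹)`. [cite: Nekovar2009HiddenSymmetries, Prop. 1.1.4, Prop. 1.1.6 (i)] -/
def isoTransport : PermWreath H X ≃* PermWreath (H.map e.toMonoidHom) X' := (congrRight τ).trans (congrLeft (subgroupIso e H))

/-- Unfolding: `isoTransport = congrLeft ∘ congrRight`. [cite: Nekovar2009HiddenSymmetries, Prop. 1.1.6 (i)] -/
theorem isoTransport_apply (u : PermWreath H X) : isoTransport e H τ u = congrLeft (subgroupIso e H) (congrRight τ u) := rfl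

/-- Unfolding (`H^X`-coordinate, in `G′`). [cite: Nekovar2009HiddenSymmetries, Prop. 1.1.6 (i)] -/
@[simp] theorem coe_isoTransport_left (u : PermWreath H X) (x' : X') :
    ((isoTransport e H τ u).left x' : G') = e ((u.left (τ.symm x') : H) : G) := rfl

/-- Unfolding (`S_{X′}`-coordinate). [cite: Nekovar2009HiddenSymmetries, Prop. 1.1.6 (i) («σ′(x′) = σ(x)′»)] -/
@[simp] theorem isoTransport_right_apply (u : PermWreath H X) (x' : X') : (isoTransport e H τ u).right x' = τ (u.right (τ.symm x')) := rfl

/-- Unfolding (inverse permutation). [cite: Nekovar2009HiddenSymmetries, Prop. 1.1.6 (i)] -/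
@[simp] theorem isoTransport_right_symm_apply (u : PermWreath H X) (x' : X') :
    (isoTransport e H τ u).right⁻¹ x' = τ (u.right⁻¹ (τ.symm x')) := rfl

/-- **Nekovář's coordinates transport as `h′ = e ∘ h ∘ τ⁻¹`.** [cite: Nekovar2009HiddenSymmetries, Prop. 1.1.6 (i) («h′(x′) = …»)] -/
theorem coe_hcoord_isoTransport (u : PermWreath H X) (x' : X') :
    ((hcoord (isoTransport e H τ u) x' : H.map e.toMonoidHom) : G') = e ((hcoord u (τ.symm x') : H) : G) := by
  rw [isoTransport_apply, hcoord_congrLeft, coe_subgroupIso_apply, hcoord_congrRight]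

end PermWreath

/-! ### §2. `ρ_s` transports: `(e, τ)·ρ_s(g) = ρ_{s′}(e g)` with `s′ = e ∘ s ∘ τ⁻¹` -/

section Embedding

variable {G G' : Type*} [Group G] [Group G'] {X X' : Type*} [MulAction G X] [MulAction G' X'] (e : G ≃* G') (τ : X ≃ X')
  (hτ : ∀ (g : G) (x : X), τ (g • x) = e g • τ x) {H : Subgroup G} {x₀ : X} {w : X → G}
include hτ

/-- Equivariance of `τ⁻¹`. [cite: Nekovar2009HiddenSymmetries, Notation («isomorphism of left Γ_ℚ-sets»)] -/
theorem equivariant_symm_smul (g' : G') (x' : X') : τ.symm (g' • x') = e.symm g' • τ.symm x' := by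
  apply τ.injective; rw [Equiv.apply_symm_apply, hτ, MulEquiv.apply_symm_apply, Equiv.apply_symm_apply]

/-- `e(H)` is the stabiliser of `τ x₀`. [cite: Nekovar2009HiddenSymmetries, §1.1.2 («fix a point x₀ ∈ X»)] -/
theorem mem_map_iff_smul_eq (hH : ∀ g : G, g ∈ H ↔ g • x₀ = x₀) (g' : G') : g' ∈ H.map e.toMonoidHom ↔ g' • τ x₀ = τ x₀ := by
  rw [Subgroup.mem_map_equiv, hH, ← τ.apply_eq_iff_eq, hτ, MulEquiv.apply_symm_apply]

/-- `s′ = e ∘ s ∘ τ⁻¹` is a section for `τ x₀`. [cite: Nekovar2009HiddenSymmetries, §1.1.2 («choose a section s»)] -/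
theorem iso_section_smul (hw : ∀ x, w x • x₀ = x) (x' : X') : e (w (τ.symm x')) • τ x₀ = x' := by
  rw [← hτ, hw, Equiv.apply_symm_apply]

/-- **`ρ_s` transports: `(e, τ)·ρ_s(g) = ρ_{s′}(e g)`** (`s′ = e ∘ s ∘ τ⁻¹`, base point `τ x₀`; any proofs of the hypotheses on the
right). [cite: Nekovar2009HiddenSymmetries, §1.1.2 (1.1.2.1), Prop. 1.1.6 (i)] -/
theorem isoTransport_wreathEmbedding (hH : ∀ g : G, g ∈ H ↔ g • x₀ = x₀) (hw : ∀ x, w x • x₀ = x)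
    (hH' : ∀ g' : G', g' ∈ H.map e.toMonoidHom ↔ g' • τ x₀ = τ x₀) (hw' : ∀ x', e (w (τ.symm x')) • τ x₀ = x') (g : G) :
    isoTransport e H τ (wreathEmbedding hH hw g) = wreathEmbedding hH' hw' (e g) := by
  refine SemidirectProduct.ext (funext fun x' => Subtype.ext ?_) (Equiv.ext fun x' => ?_)
  · rw [coe_isoTransport_left, coe_wreathEmbedding_left, coe_wreathEmbedding_left, map_mul, map_mul, map_inv,
      equivariant_symm_smul e τ hτ, map_inv, MulEquiv.symm_apply_apply]
  · rw [isoTransport_right_apply, wreathEmbedding_right_apply, wreathEmbedding_right_apply, hτ, Equiv.apply_symm_apply]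

end Embedding

/-! ### §3. `ˢF̃_α` transports along `(e, τ)` -/

section HalfTransfer

variable {G G' : Type*} [Group G] [Group G'] {X X' : Type*} [MulAction G X] [MulAction G' X'] (e : G ≃* G') (τ : X ≃ X')
  (hτ : ∀ (g : G) (x : X), τ (g • x) = e g • τ x) {H N : Subgroup G} {c : G} {x₀ : X} {w : X → G}

include hτ in
/-- **The hypotheses of §1.3 transport along `(e, τ)`** to `(e(H), e(N), e c, τ x₀)`. [cite: Nekovar2009HiddenSymmetries, §1.3] -/
theorem IsCMStabilizerPair.isoTransport (hD : IsCMStabilizerPair H N c x₀) :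
    IsCMStabilizerPair (X := X') (H.map e.toMonoidHom) (N.map e.toMonoidHom) (e c) (τ x₀) where
  mem_iff := mem_map_iff_smul_eq e τ hτ hD.mem_iff
  le := Subgroup.map_mono hD.le
  conj_notMem g' h := by
    rw [Subgroup.mem_map_equiv, map_mul, map_mul, map_inv, MulEquiv.symm_apply_apply] at h
    exact hD.conj_notMem _ h
  smul_eq x' := by rw [← τ.apply_symm_apply x', ← hτ, hD.smul_eq]
  mem_or_mem g' h := by
    rw [Subgroup.mem_map_equiv] at h
    rcases hD.mem_or_mem _ h with h1 | h1
    · exact Or.inl (Subgroup.mem_map_equiv.2 h1)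
    · refine Or.inr (Subgroup.mem_map_equiv.2 ?_)
      rwa [map_mul, MulEquiv.symm_apply_apply]
  mul_self := by rw [← map_mul, hD.mul_self, map_one]

omit [MulAction G X] [MulAction G' X'] in
/-- `\overline{e h}` (for `e(N)`) `= h̄` (for `N`). [cite: Nekovar2009HiddenSymmetries, §2.1.1 («h̄»)] -/
theorem cmParity_map (h : G) : cmParity (N.map e.toMonoidHom) (e h) = cmParity N h := by
  by_cases hh : h ∈ N
  · rw [cmParity_of_mem hh, cmParity_of_mem ((mem_map_toMonoidHom_iff e N h).2 hh)]
  · rw [cmParity_of_notMem hh, cmParity_of_notMem (fun h' => hh ((mem_map_toMonoidHom_iff e N h).1 h'))]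

omit [MulAction G X] [MulAction G' X'] in
/-- `e(s(τ⁻¹x′)⁻¹ c^a s(τ⁻¹x′)) = s′(x′)⁻¹ (e c)^a s′(x′)`. [cite: Nekovar2009HiddenSymmetries, §2.1.2] -/
theorem liftConj_isoTransport (a : ZMod 2) (x' : X') :
    e (liftConj w c a (τ.symm x')) = liftConj (fun x' => e (w (τ.symm x'))) (e c) a x' := by
  rw [liftConj_def, liftConj_def, map_mul, map_mul, map_inv, map_bitPow]

omit [MulAction G X] [MulAction G' X'] in
/-- **(2.1.1.5) transports: `((e,τ)·u)(α ∘ τ⁻¹) = (uα) ∘ τ⁻¹`.** [cite: Nekovar2009HiddenSymmetries, §2.1.1 (2.1.1.5)] -/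
theorem typeAct_isoTransport (u : PermWreath H X) (α : X → ZMod 2) :
    typeAct (N.map e.toMonoidHom) (PermWreath.isoTransport e H τ u) (fun x' => α (τ.symm x')) =
      fun x' => typeAct N u α (τ.symm x') := by
  funext x'
  rw [typeAct_apply, typeAct_apply, coe_isoTransport_left, isoTransport_right_symm_apply, Equiv.symm_apply_apply, cmParity_map]

omit [MulAction G X] [MulAction G' X'] in
/-- **The factors of (2.1.3) transport**: the factor of `^{s′}F̃_{α∘τ⁻¹}((e,τ)·u)` at `x′` is `e` of the factor of `ˢF̃_α(u)` at `τ⁻¹x′`.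
[cite: Nekovar2009HiddenSymmetries, Prop.–Def. 2.1.3] -/
theorem ghtBracket_isoTransport (α : X → ZMod 2) (u : PermWreath H X) (x' : X') :
    ghtBracket (N.map e.toMonoidHom) (fun x' => e (w (τ.symm x'))) (e c) (fun x' => α (τ.symm x'))
        (PermWreath.isoTransport e H τ u) x' = e (ghtBracket N w c α u (τ.symm x')) := by
  rw [ghtBracket_def, ghtBracket_def, coe_hcoord_isoTransport, cmParity_map, map_mul, map_mul, liftConj_isoTransport, isoTransport_right_apply,
    ← liftConj_isoTransport e τ _ (τ (u.right (τ.symm x'))), Equiv.symm_apply_apply]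

variable (hD : IsCMStabilizerPair H N c x₀) (hw : ∀ x, w x • x₀ = x) {A : Type*} [CommGroup A] (ϕ : N →* A)

/-- **`ˢF̃_α` transports along `(e, τ)`: `^{s′}F̃′_{α∘τ⁻¹}((e,τ)·u) = ˢF̃_α(u)`** for `ϕ′ = ϕ ∘ e⁻¹ : e(N) → A`, `s′ = e ∘ s ∘ τ⁻¹`, base
point `τ x₀` (any proofs of the hypotheses on the left; the product is reindexed by `τ`). [cite: Nekovar2009HiddenSymmetries, Prop.–Def. 2.1.3, Notation] -/
theorem genHalfTransferWith_isoTransport (hD' : IsCMStabilizerPair (X := X') (H.map e.toMonoidHom) (N.map e.toMonoidHom) (e c) (τ x₀))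
    (hw' : ∀ x', e (w (τ.symm x')) • τ x₀ = x') (α : X → ZMod 2) (u : PermWreath H X) :
    genHalfTransferWith hD' hw' (ϕ.comp (subgroupIso e N).symm.toMonoidHom) (fun x' => α (τ.symm x'))
        (PermWreath.isoTransport e H τ u) = genHalfTransferWith hD hw ϕ α u := by
  rw [genHalfTransferWith_def, genHalfTransferWith_def]
  have key : ∀ x : X, ϕ ⟨ghtBracket N w c α u x, hD.ghtBracket_mem hw α u x⟩ =
      (ϕ.comp (subgroupIso e N).symm.toMonoidHom)
        ⟨ghtBracket (N.map e.toMonoidHom) (fun x' => e (w (τ.symm x'))) (e c) (fun x' => α (τ.symm x'))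
          (PermWreath.isoTransport e H τ u) (τ x), hD'.ghtBracket_mem hw' _ _ (τ x)⟩ := fun x => by
    rw [MonoidHom.comp_apply, MulEquiv.coe_toMonoidHom]
    congr 1
    refine Subtype.ext ?_
    rw [coe_subgroupIso_symm_apply]
    show ghtBracket N w c α u x = e.symm (ghtBracket (N.map e.toMonoidHom) (fun x' => e (w (τ.symm x'))) (e c)
      (fun x' => α (τ.symm x')) (PermWreath.isoTransport e H τ u) (τ x))
    rw [ghtBracket_isoTransport, MulEquiv.symm_apply_apply, Equiv.symm_apply_apply]
  exact (finprod_eq_of_bijective (fun x => τ x) τ.bijective key).symm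

include hτ in
/-- **`^{s′}F̃′_{α′}(ρ_{s′}(e g)) = ˢF̃_α(ρ_s(g))`**: the generalised half-transfer against `ρ_s` — hence `F_Φ` — is unchanged under the
change of model `(e, τ) : (G, X) ≅ (G′, X′)` (`ϕ′ = ϕ ∘ e⁻¹`, `s′ = e ∘ s ∘ τ⁻¹`, `α′ = α ∘ τ⁻¹`).
[cite: Nekovar2009HiddenSymmetries, Prop.–Def. 2.1.3, Notation («isomorphism of left Γ_ℚ-sets»)] -/
theorem genHalfTransferWith_isoTransport_wreathEmbedding
    (hD' : IsCMStabilizerPair (X := X') (H.map e.toMonoidHom) (N.map e.toMonoidHom) (e c) (τ x₀))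
    (hw' : ∀ x', e (w (τ.symm x')) • τ x₀ = x') (α : X → ZMod 2) (g : G) :
    genHalfTransferWith hD' hw' (ϕ.comp (subgroupIso e N).symm.toMonoidHom) (fun x' => α (τ.symm x'))
        (wreathEmbedding hD'.mem_iff hw' (e g)) =
      genHalfTransferWith hD hw ϕ α (wreathEmbedding hD.mem_iff hw g) := by
  rw [← isoTransport_wreathEmbedding e τ hτ hD.mem_iff hw hD'.mem_iff hw' g, genHalfTransferWith_isoTransport e τ hD hw ϕ hD' hw']

end HalfTransfer

end Literature.NumberTheory.ComplexMultiplication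

end
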